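import Literature.NumberTheory.Weil1964.LocalWeilIndexNormForm
import Literature.NumberTheory.Weil1964.LocalWeilIndexSpace
import Literature.NumberTheory.Automorphic.UnitaryGroupSymplecticEmbedding
import Literature.LinearAlgebra.Semilinear.HermitianOrthogonalBasis
import HarnessLib

/-!
# The Weil index of the restriction of scalars of a hermitian form: `γ_ψ(Res_{K/k} b) = (d, det b)_k · (γ⁰_d)^r`
# ([HarrisKudlaSweet1996, §1 (1.16)]; [Kudla1994, §3])

Topic `NumberTheory/Weil1964`; namespace `Literature.NumberTheory.Weil1964`.  KERNEL ONLY (definitions with bodies +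
theorems; no named fact, no `sorry`).  Sequel of `LocalWeilIndexNormForm.lean` (L3 of the GR-1 local package: the
DIAGONAL case `γ(⊕ᵢ aᵢ · N_{K/k}) = (d, ∏ aᵢ)_k (γ⁰_d)^r`) and of `LinearAlgebra/Semilinear/HermitianOrthogonalBasis.lean`
(orthogonal bases of hermitian forms).

Setting: `k = K_v` a non-archimedean completion of a number field, `S` a FIELD which is a `k`-algebra with quadratic
coordinates `Ψ : k × k ≃ S`, `Ψ(a, b) = a + b δ`, `δ² = d ≠ 0` (tree `IsQuadraticCoordinates`; the case in point is
`S = E ⊗_F F_v = E_w` at a place `v` of `F` INERT OR RAMIFIED in the quadratic extension `E`), `σ` the `k`-involution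
of `S` with `σ δ = -δ`.  For a hermitian matrix `H ∈ M_r(S)` (`σ(H i j) = H j i`) the hermitian form
`h(x, y) = ᵗ(σx) H y` (tree `hermForm`) takes σ-invariant values on the diagonal, and its RESTRICTION OF SCALARS
`Res h : x ↦ h(x, x) ∈ k` is a quadratic form on the `2r`-dimensional `k`-space `S^r` (`resQF`).

* §1 `hermSesq σ H`: `h` as a Mathlib sesquilinear form `(S^r) →ₛₗ[σ] (S^r) →ₗ[S] S`, hermitian (`LinearMap.IsSymm`)
  when `H` is; §2 `resQF`: `Res h` as a `QuadraticForm k (Fin r → S)`;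
* §3 `(d, s² - d t²)_k = 1` (norms are killed by the quadratic character `ε_{S/k} = (d, ·)_k`);
* §4 **THE FORMULA** (`weilIndexSpace_resQF`): for `H` hermitian with `det H ≠ 0`,
  **`γ_ψ(Res h) = (d, det H)_k · (γ⁰_d)^r`**, `γ⁰_d = γ_ψ(1)γ_ψ(-d)` (`normFormIndex`), `det H ∈ k` (σ-invariant).
  Proof: an `h`-orthogonal `S`-basis `(vᵢ)` (`exists_orthogonal_basis_of_isSymm`) with `h(vᵢ, vᵢ) = aᵢ ∈ kˣ` gives the
  `k`-isometry `Res h ≅ ⊕ᵢ aᵢ · N_{S/k}` (`N(s + tδ) = s² - d t²`), whose index is `(d, ∏ aᵢ)_k (γ⁰_d)^r` by L3; and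
  `∏ aᵢ = N(det P) · det H` for the base-change matrix `P`, with `(d, N(det P))_k = 1` by §3.

This is [HarrisKudlaSweet1996, §1 (1.16)] "`γ_F(η ∘ RV) = (Δ, det V)_F γ_F(-Δ, η)^m γ_F(-1, η)^{-m}`" (the Weil index
of the restriction of scalars `RV` of an `m`-dimensional hermitian space `V` over the quadratic extension with
discriminant `Δ`) in the normalisation `γ⁰ = γ(1)γ(-d)`; it is the local constant entering Kudla's splitting
`β_V(w_S ·) = … γ_F(η ∘ RV)^{-j}` ([Kudla1994, Thm 3.1]; [HarrisKudlaSweet1996, (1.16)–(1.19)]) and the Weil index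
of the Leray invariant of three `E`-rational Lagrangians (GR-1 local package, step L2).

Written for the kernel construction of the cited input `hGRU` of the Hodge-CM period-theorem package (stage-1 cell
`pub-hodgecm`, seat GR-1, 2026-08-21); nothing here is a claim of the manuscripts adjudicated by that cell.

## References

* M. Harris, S. S. Kudla, W. J. Sweet, J. Amer. Math. Soc. 9 (1996) 941–1004, §1 (1.16) [HarrisKudlaSweet1996].
* S. S. Kudla, Israel J. Math. 87 (1994) 361–401, Thm 3.1 [Kudla1994].
* O. T. O'Meara, *Introduction to quadratic forms* (1963), §63B [Omeara1963].
-/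

set_option autoImplicit false

noncomputable section

open NumberField IsDedekindDomain MeasureTheory Matrix Module
open Literature.NumberTheory.Automorphic.UnitaryGroup
open Literature.NumberTheory.Automorphic.UnitaryGroup.QuadraticCoordinates
open Literature.NumberTheory.QuadraticForms
open Literature.LinearAlgebra.Semilinear

namespace Literature.NumberTheory.Weil1964

/-! ## §1 The hermitian form of a matrix as a sesquilinear map -/

section Sesq

variable {S : Type*} [CommRing S] (σ : S →+* S) {n : Type*} [Fintype n]

/-- `h(x, y) = ᵗ(σx) H y` (tree `hermForm`) as a Mathlib sesquilinear map, `σ`-semilinear in `x`, linear in `y`.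
[folklore] -/
def hermSesq (H : Matrix n n S) : (n → S) →ₛₗ[σ] (n → S) →ₗ[S] S :=
  LinearMap.mk₂'ₛₗ σ (RingHom.id S) (fun x y => hermForm σ H x y)
    (fun x x' y => by
      simp only [hermForm_apply]
      rw [show (⇑σ ∘ (x + x')) = ⇑σ ∘ x + ⇑σ ∘ x' from funext fun i => by simp, add_dotProduct])
    (fun c x y => by
      simp only [hermForm_apply, smul_eq_mul]
      rw [show (⇑σ ∘ (c • x)) = σ c • (⇑σ ∘ x) from funext fun i => by simp, smul_dotProduct, smul_eq_mul])
    (fun x y y' => by simp only [hermForm_apply, mulVec_add, dotProduct_add])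
    (fun c x y => by simp only [hermForm_apply, mulVec_smul, dotProduct_smul, RingHom.id_apply])

/-- unfolding. [folklore] -/
@[simp] private theorem hermSesq_apply (H : Matrix n n S) (x y : n → S) : hermSesq σ H x y = hermForm σ H x y := rfl

/-- for an involution `σ` and a hermitian matrix (`σ(H i j) = H j i`), `hermSesq σ H` is hermitian in Mathlib's sense
`LinearMap.IsSymm`: `σ(h(x, y)) = h(y, x)`. [folklore] -/
private theorem hermSesq_isSymm (hσσ : ∀ z, σ (σ z) = z) {H : Matrix n n S} (hH : ∀ i j, σ (H i j) = H j i) :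
    (hermSesq σ H).IsSymm := by
  refine ⟨fun x y => ?_⟩
  change σ (hermForm σ H x y) = hermForm σ H y x
  simp only [hermForm_apply, dotProduct, mulVec, Function.comp_apply, map_sum, map_mul, hσσ, hH, Finset.mul_sum]
  rw [Finset.sum_comm]
  exact Finset.sum_congr rfl fun i _ => Finset.sum_congr rfl fun j _ => by ring

/-- `h(vᵢ, vⱼ)` is the `(i, j)` entry of `ᵗ(σP) H P` for the matrix `P` with columns `vᵢ`. [folklore] -/
private theorem hermForm_eq_conjTranspose_mul_mul_apply {m : Type*} [Fintype m] (H : Matrix n n S) (v : m → n → S)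
    (i j : m) :
    hermForm σ H (v i) (v j) = (((Matrix.of fun a i => v i a).map σ)ᵀ * H * Matrix.of fun a i => v i a) i j := by
  simp only [hermForm, dotProduct, mulVec, Function.comp_apply, Matrix.mul_apply, Matrix.transpose_apply,
    Matrix.map_apply, Matrix.of_apply, Finset.mul_sum, Finset.sum_mul]
  rw [Finset.sum_comm]
  exact Finset.sum_congr rfl fun a _ => Finset.sum_congr rfl fun b _ => by ring

end Sesq

/-! ## §2 Restriction of scalars of a hermitian form along quadratic coordinates -/

section Res

variable {k : Type*} [Field k] {S : Type*} [CommRing S] [Algebra k S] {Ψ : (k × k) ≃+ S} {δ : S} {d : k}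
  (h : IsQuadraticCoordinates (algebraMap k S) Ψ δ d) {σ : S →+* S}
  (hσφ : ∀ a, σ (algebraMap k S a) = algebraMap k S a) (hσδ : σ δ = -δ)

include h hσφ hσδ in
/-- `σ` is an involution: `σ(a + bδ) = a - bδ`. [folklore] -/
private theorem conj_conj (z : S) : σ (σ z) = z := by
  conv_lhs => rw [← h.re_add_im z]
  conv_rhs => rw [← h.re_add_im z]
  simp only [map_add, map_mul, hσφ, hσδ, map_neg, neg_neg]

include h hσφ hσδ in
/-- **the norm form**: `σ(z) z = (re z)² - d (im z)²`. [folklore] -/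
private theorem conj_mul_self (z : S) : σ z * z = algebraMap k S (re Ψ z ^ 2 - d * im Ψ z ^ 2) := by
  rw [← h.re_add_im (σ z * z), h.re_mul, h.im_mul, h.re_conj hσφ hσδ, h.im_conj hσφ hσδ]
  have e : re Ψ z * im Ψ z + -im Ψ z * re Ψ z = 0 := by ring
  rw [e, map_zero, zero_mul, add_zero]
  congr 1
  ring

include h hσφ hσδ in
/-- a `σ`-invariant element is "real": `σ t = t ⇒ t = re t` (`2 ≠ 0` in `k`). [folklore] -/
private theorem eq_algebraMap_re_of_conj_eq (h2 : (2 : k) ≠ 0) {t : S} (ht : σ t = t) : t = algebraMap k S (re Ψ t) := by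
  have him : im Ψ t = 0 := by
    have e := h.im_conj hσφ hσδ t
    rw [ht] at e
    have e2 : (2 : k) * im Ψ t = 0 := by linear_combination e
    exact (mul_eq_zero.1 e2).resolve_left h2
  conv_lhs => rw [← h.re_add_im t, him, map_zero, zero_mul, add_zero]

variable (σ) in
/-- **restriction of scalars of the hermitian form `h_H`**: the `k`-bilinear form `(x, y) ↦ re h(x, y)` on `S^n`.
[cite: HarrisKudlaSweet1996, §1 (1.16) (the space `RV`)] -/
def resBilin {n : Type*} [Fintype n] (H : Matrix n n S) : LinearMap.BilinForm k (n → S) :=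
  LinearMap.mk₂ k (fun x y => re Ψ (hermForm σ H x y))
    (fun x x' y => by rw [← hermSesq_apply, map_add, LinearMap.add_apply, map_add]; rfl)
    (fun c x y => by
      rw [← hermSesq_apply, ← algebraMap_smul S c x, LinearMap.map_smulₛₗ₂, hσφ, hermSesq_apply, smul_eq_mul,
        h.re_map_mul, smul_eq_mul])
    (fun x y y' => by rw [← hermSesq_apply, map_add, map_add]; rfl)
    (fun c x y => by
      rw [← hermSesq_apply, ← algebraMap_smul S c y, map_smul, hermSesq_apply, smul_eq_mul, h.re_map_mul,
        smul_eq_mul])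

/-- unfolding. [cite: HarrisKudlaSweet1996, §1 (1.16)] -/
@[simp] theorem resBilin_apply {n : Type*} [Fintype n] (H : Matrix n n S) (x y : n → S) :
    resBilin h σ hσφ H x y = re Ψ (hermForm σ H x y) := rfl

variable (σ) in
/-- **`Res h`**: the quadratic form `x ↦ h(x, x)` (a `σ`-invariant, i.e. "real", value; we take its `re`) on the
`k`-space `S^n`. [cite: HarrisKudlaSweet1996, §1 (1.16) (the quadratic space `RV`)] -/
def resQF {n : Type*} [Fintype n] (H : Matrix n n S) : QuadraticForm k (n → S) :=
  (resBilin h σ hσφ H).toQuadraticMap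

/-- unfolding: `Res h (x) = re h(x, x)`. [cite: HarrisKudlaSweet1996, §1 (1.16)] -/
@[simp] theorem resQF_apply {n : Type*} [Fintype n] (H : Matrix n n S) (x : n → S) :
    resQF h σ hσφ H x = re Ψ (hermForm σ H x x) := rfl

/-- the quadratic coordinates of `S^n`: `(u_{i,0}, u_{i,1})ᵢ ↦ (u_{i,0} + u_{i,1} δ)ᵢ`, a `k`-linear isomorphism
`k^{n × 2} ≃ S^n`. [folklore] -/
def coordEquiv (n : Type*) : (n × Fin 2 → k) ≃ₗ[k] (n → S) where
  toFun u i := Ψ (u (i, 0), u (i, 1))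
  invFun x p := ![re Ψ (x p.1), im Ψ (x p.1)] p.2
  map_add' u u' := funext fun i => by
    simp only [Pi.add_apply]
    rw [← map_add, Prod.mk_add_mk]
  map_smul' c u := funext fun i => by
    simp only [Pi.smul_apply, smul_eq_mul, RingHom.id_apply]
    rw [h.apply, h.apply, Algebra.smul_def, map_mul, map_mul]
    ring
  left_inv u := by
    funext ⟨i, t⟩
    fin_cases t
    · simp [re_apply]
    · simp [im_apply]
  right_inv x := funext fun i => by
    simp only [Matrix.cons_val_zero, Matrix.cons_val_one]
    exact apply_re_im Ψ (x i)

/-- formula. [folklore] -/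
@[simp] private theorem coordEquiv_apply (n : Type*) (u : n × Fin 2 → k) (i : n) :
    coordEquiv h n u i = Ψ (u (i, 0), u (i, 1)) := rfl

end Res

/-! ## §3 Norms are killed by `(d, ·)_k` -/

section HilbertNorm

variable {F : Type*} [Field F]

/-- **`(d, s² - d t²)_F = 1`** for `(s, t) ≠ (0, 0)`, `d ≠ 0`, `2 ≠ 0`: `d x² + (s² - d t²) y² = 1` has the solution
`(t/s, 1/s)` if `s ≠ 0` and `((d⁻¹ + 1)/2, (d⁻¹ - 1)/(2t))` if `s = 0`. [cite: Omeara1963, §63B, 63:10] -/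
theorem hilbertSymbol_norm_eq_one (h2 : (2 : F) ≠ 0) {d s t : F} (hd : d ≠ 0) (hst : s ≠ 0 ∨ t ≠ 0) :
    hilbertSymbol F d (s ^ 2 - d * t ^ 2) = 1 := by
  rw [hilbertSymbol_eq_one_iff]
  rcases eq_or_ne s 0 with rfl | hs
  · have ht : t ≠ 0 := hst.resolve_left fun h => h rfl
    refine ⟨(d⁻¹ + 1) / 2, (d⁻¹ - 1) / (2 * t), ?_⟩
    field_simp
    ring
  · refine ⟨t / s, 1 / s, ?_⟩
    field_simp
    ring

end HilbertNorm

/-! ## §4 The formula `γ(Res h) = (d, det H)_k (γ⁰_d)^r` -/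

section Formula

variable (K : Type) [Field K] [NumberField K] (v : HeightOneSpectrum (𝓞 K))

/-- `K_v` has characteristic `0`. [folklore] -/
private theorem two_ne_zero_adicCompletion : (2 : v.adicCompletion K) ≠ 0 :=
  haveI : CharZero (v.adicCompletion K) := charZero_of_injective_algebraMap (algebraMap K _).injective
  two_ne_zero

variable [MeasurableSpace (v.adicCompletion K)] [BorelSpace (v.adicCompletion K)]
  (μ : Measure (v.adicCompletion K)) [μ.IsAddHaarMeasure] {ψ : AddChar (v.adicCompletion K) Circle}

variable {S : Type*} [Field S] [Algebra (v.adicCompletion K) S] [FiniteDimensional (v.adicCompletion K) S]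
  {Ψ : (v.adicCompletion K × v.adicCompletion K) ≃+ S} {δ : S} {d : v.adicCompletion K}
  (h : IsQuadraticCoordinates (algebraMap (v.adicCompletion K) S) Ψ δ d) {σ : S →+* S}
  (hσφ : ∀ a, σ (algebraMap (v.adicCompletion K) S a) = algebraMap (v.adicCompletion K) S a) (hσδ : σ δ = -δ)

include hσδ in
/-- **THE WEIL INDEX OF THE RESTRICTION OF SCALARS OF A NON-DEGENERATE HERMITIAN FORM**:
`γ_ψ(Res h_H) = (d, det H)_k · (γ⁰_d)^r` for `H ∈ M_r(S)` hermitian with `det H ≠ 0` (`det H` is `σ`-invariant, read in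
`k` through `re`). [cite: HarrisKudlaSweet1996, §1 (1.16)] -/
theorem weilIndexSpace_resQF (hψ : ψ.IsContinuousNontrivial) (hd : d ≠ 0) {r : ℕ}
    (H : Matrix (Fin r) (Fin r) S) (hH : ∀ i j, σ (H i j) = H j i) (hHd : H.det ≠ 0) :
    weilIndexSpace ψ μ (resQF h σ hσφ H) =
      (hilbertSymbol (v.adicCompletion K) d (re Ψ H.det) : ℂ) * normFormIndex K v ψ μ d ^ r := by
  have h2 := two_ne_zero_adicCompletion K v
  have hσσ := conj_conj h hσφ hσδ
  have hδ0 : δ ≠ 0 := by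
    intro hδ
    apply hd
    have e := h.mul_self
    rw [hδ, mul_zero] at e
    exact (map_eq_zero_iff _ (algebraMap (v.adicCompletion K) S).injective).1 e.symm
  have h2S : (2 : S) ≠ 0 := by
    rw [show (2 : S) = algebraMap (v.adicCompletion K) S 2 from (map_ofNat _ 2).symm]
    exact (map_ne_zero_iff _ (algebraMap (v.adicCompletion K) S).injective).2 h2
  -- §a an `h`-orthogonal `S`-basis `v` of `S^r`
  have hsymm := hermSesq_isSymm σ hσσ hH
  obtain ⟨w, hw⟩ := exists_orthogonal_basis_of_isSymm (V := Fin r → S) h2S hδ0 hσδ hsymm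
  have hm : finrank S (Fin r → S) = r := Module.finrank_fin_fun S
  let b : Basis (Fin r) S (Fin r → S) := w.reindex (finCongr hm)
  have hb : ∀ i j, i ≠ j → hermForm σ H (b i) (b j) = 0 := fun i j hij => by
    have hne : (finCongr hm).symm i ≠ (finCongr hm).symm j := fun e =>
      hij (by simpa using congrArg (finCongr hm) e)
    have := hw hne
    simp only [b, Basis.reindex_apply]
    exact this
  -- §b the diagonal coefficients `aᵢ = h(bᵢ, bᵢ) ∈ k`
  set a : Fin r → v.adicCompletion K := fun i => re Ψ (hermForm σ H (b i) (b i)) with ha_def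
  have hdiag : ∀ i, hermForm σ H (b i) (b i) = algebraMap _ S (a i) := fun i =>
    eq_algebraMap_re_of_conj_eq h hσφ hσδ h2 (hsymm.eq (b i) (b i))
  have hB : ∀ i j, hermForm σ H (b i) (b j) = if i = j then algebraMap _ S (a i) else 0 := fun i j => by
    split_ifs with hij
    · subst hij; exact hdiag i
    · exact hb i j hij
  -- §c the base-change matrix `P` and `∏ aᵢ = N(det P) · det H`
  let P : Matrix (Fin r) (Fin r) S := Matrix.of fun c i => b i c
  have hPdef : P = (Pi.basisFun S (Fin r)).toMatrix b := by
    ext c i; simp [P, Basis.toMatrix_apply]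
  have hPunit : IsUnit P.det := by
    have e := (Pi.basisFun S (Fin r)).toMatrix_mul_toMatrix_flip b
    rw [← hPdef] at e
    exact isUnit_iff_exists_inv.2 ⟨_, by rw [← Matrix.det_mul, e, Matrix.det_one]⟩
  have hD : (P.map σ)ᵀ * H * P = Matrix.diagonal fun i => algebraMap _ S (a i) := by
    ext i j
    rw [Matrix.diagonal_apply, ← hB i j]
    exact (hermForm_eq_conjTranspose_mul_mul_apply σ H (fun i => (b i : Fin r → S)) i j).symm
  have hdetH : σ H.det = H.det := by
    rw [RingHom.map_det, RingHom.mapMatrix_apply]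
    have : H.map σ = Hᵀ := by ext i j; exact hH i j
    rw [this, Matrix.det_transpose]
  have hdetH' : H.det = algebraMap _ S (re Ψ H.det) := eq_algebraMap_re_of_conj_eq h hσφ hσδ h2 hdetH
  set z := P.det with hz_def
  have hprod : algebraMap _ S (∏ i, a i) = σ z * z * H.det := by
    have e := congrArg Matrix.det hD
    rw [Matrix.det_diagonal, Matrix.det_mul, Matrix.det_mul, Matrix.det_transpose, ← RingHom.mapMatrix_apply,
      ← RingHom.map_det] at e
    rw [map_prod, ← e]
    ring
  have hprod' : ∏ i, a i = (re Ψ z ^ 2 - d * im Ψ z ^ 2) * re Ψ H.det := by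
    apply (algebraMap (v.adicCompletion K) S).injective
    rw [hprod, conj_mul_self h hσφ hσδ z, map_mul, ← hdetH']
  have hz : z ≠ 0 := hPunit.ne_zero
  have hnorm : re Ψ z ^ 2 - d * im Ψ z ^ 2 ≠ 0 := by
    intro e
    apply hz
    have e2 := conj_mul_self h hσφ hσδ z
    rw [e, map_zero] at e2
    rcases mul_eq_zero.1 e2 with e3 | e3
    · simpa [hσσ] using congrArg σ e3
    · exact e3
  have hreH : re Ψ H.det ≠ 0 := by
    intro e; apply hHd; rw [hdetH', e, map_zero]
  have ha : ∀ i, a i ≠ 0 := fun i hi => by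
    have : ∏ i, a i = 0 := Finset.prod_eq_zero (Finset.mem_univ i) hi
    rw [hprod'] at this
    exact mul_ne_zero hnorm hreH this
  -- §d `Res h ∘ (coordinates in the basis b) = ⊕ᵢ aᵢ (x² - d y²)`
  let c : Fin r × Fin 2 → v.adicCompletion K := diagHermCoeff K v a d
  let eqv : (Fin r × Fin 2 → v.adicCompletion K) ≃ₗ[v.adicCompletion K] (Fin r → S) :=
    (coordEquiv h (Fin r)).trans (b.equivFun.symm.restrictScalars (v.adicCompletion K))
  have hcomp : ∀ u, resQF h σ hσφ H (eqv u) = QuadraticMap.weightedSumSquares (v.adicCompletion K) c u := by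
    intro u
    have hx : eqv u = ∑ i, (Ψ (u (i, 0), u (i, 1))) • b i := by
      change b.equivFun.symm (coordEquiv h (Fin r) u) = _
      rw [Basis.equivFun_symm_apply]
      rfl
    rw [resQF_apply, hx, ← hermSesq_apply, LinearMap.map_sum₂]
    simp only [map_sum, LinearMap.map_smulₛₗ₂, map_smul, smul_eq_mul, hermSesq_apply, hB, mul_ite, mul_zero,
      Finset.sum_ite_eq, Finset.mem_univ, if_true]
    rw [QuadraticMap.weightedSumSquares_apply, Fintype.sum_prod_type]
    refine Finset.sum_congr rfl fun i _ => ?_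
    rw [Fin.sum_univ_two, ← mul_assoc, mul_comm (Ψ (u (i, 0), u (i, 1))) (σ (Ψ (u (i, 0), u (i, 1)))),
      conj_mul_self h hσφ hσδ, ← map_mul, h.re_map]
    have e0 : re Ψ (Ψ (u (i, 0), u (i, 1))) = u (i, 0) := re_apply Ψ _ _
    have e1 : im Ψ (Ψ (u (i, 0), u (i, 1))) = u (i, 1) := im_apply Ψ _ _
    rw [e0, e1]
    simp only [c, diagHermCoeff, scaledNormCoeff, Matrix.cons_val_zero, Matrix.cons_val_one, smul_eq_mul]
    ring
  -- §e assemble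
  have hc : ∀ p, c p ≠ 0 := by
    rintro ⟨i, t⟩
    fin_cases t
    · exact ha i
    · exact neg_ne_zero.2 (mul_ne_zero hd (ha i))
  have hcomp' : ∀ u, ((resQF h σ hσφ H).comp (eqv : _ →ₗ[v.adicCompletion K] (Fin r → S))) u =
      QuadraticMap.weightedSumSquares (v.adicCompletion K) c
        ((LinearEquiv.refl (v.adicCompletion K) (Fin r × Fin 2 → v.adicCompletion K)) u) := fun u => by
    rw [QuadraticMap.comp_apply, LinearEquiv.coe_coe, LinearEquiv.refl_apply]
    exact hcomp u
  rw [← weilIndexSpace_comp_linearEquiv μ hψ (resQF h σ hσφ H) eqv, weilIndexSpace_eq_weilIndexQF' μ hψ,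
    weilIndexQF'_eq_weilIndexDiag μ hψ hcomp']
  calc weilIndexDiag ψ μ c
      = ∏ p, weilIndex ψ μ (c p) := weilIndexDiag_of_ne_zero ψ μ hc
    _ = ∏ i, (weilIndex ψ μ (a i) * weilIndex ψ μ (-(d * a i))) := by
        rw [Fintype.prod_prod_type]
        refine Finset.prod_congr rfl fun i _ => ?_
        rw [Fin.prod_univ_two]
        rfl
    _ = ∏ i, ((hilbertSymbol (v.adicCompletion K) d (a i) : ℂ) * normFormIndex K v ψ μ d) :=
        Finset.prod_congr rfl fun i _ => weilIndex_mul_weilIndex_neg_mul_eq K v μ hψ (ha i) hd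
    _ = (hilbertSymbol (v.adicCompletion K) d (∏ i, a i) : ℂ) * normFormIndex K v ψ μ d ^ r := by
        rw [Finset.prod_mul_distrib, prod_hilbertSymbol_adicCompletion_right K v a ha hd, Finset.prod_const,
          Finset.card_univ, Fintype.card_fin]
    _ = (hilbertSymbol (v.adicCompletion K) d (re Ψ H.det) : ℂ) * normFormIndex K v ψ μ d ^ r := by
        rw [hprod', hilbertSymbol_adicCompletion_mul_right K v hnorm hreH hd,
          hilbertSymbol_norm_eq_one h2 hd ?_, one_mul]
        by_contra hcon
        simp only [not_or, not_ne_iff] at hcon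
        apply hnorm
        rw [hcon.1, hcon.2]
        ring

end Formula

end Literature.NumberTheory.Weil1964
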